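import Mathlib
import Summits.Ventures.HodgeRepro2.T5HeckeDoubleCoset

/-!
# `H(G, K) = e_K H(G, K') e_K`: the Hecke algebras as a directed system of corners

Blind cell `pub-hodge-repro2`, seat p8 (gen 8), Tier-5 kernel support.  The last cell of the Hecke
dictionary left as prose (route/T5-CHECK-N3-p8.md §12.2 rows 3–5, «`H(G)` itself») is the
convolution algebra `H(G) = ⋃_K H(G, K)`: for `K' ⊆ K` the unit `e_K` of `H(G, K)` is an idempotent
of `H(G, K')` and `H(G, K) = e_K H(G, K') e_K`.  This file records that sentence Haar-measure-free
in the permutation model of `T5HeckePermutationModule` (T5-52: `H(G, K) = End_G(k[G ⧸ K])`), for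
`K' ≤ K` with `[K : K'] < ∞` and characteristic `0`:

* `proj : k[G ⧸ K'] →ₗ[k] k[G ⧸ K]` — the `G`-map `xK' ↦ xK`, and `sect : k[G ⧸ K] →ₗ[k] k[G ⧸ K']`
  — the `G`-map `xK ↦ [K : K']⁻¹ ∑_{y ∈ xK/K'} yK'` (Frobenius reciprocity applied to the `K`-fixed
  vector `[K : K']⁻¹ 1_{K/K'}`), with `proj_comp_sect : proj ∘ sect = id`;
* `incl : heckeAlgebra k K → heckeAlgebra k K'`, `T ↦ sect ∘ T ∘ proj` — THE INCLUSION OF HECKE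
  ALGEBRAS: `k`-linear (`inclₗ`), multiplicative (`incl_mul`), injective (`incl_injective`), not
  unital: `incl 1 = levelIdem`, the LEVEL IDEMPOTENT `e_K := sect ∘ proj ∈ H(G, K')`
  (`isIdempotentElem_levelIdem`);
* `incl_eq_levelIdem_mul_mul` and `exists_incl_eq_of_corner` — the image of `incl` is exactly the
  corner `e_K H(G, K') e_K`;
* `heckeSMul_incl` — the actions are compatible: on `V^K ⊆ V^{K'}`, `incl T` acts as `T`;
* `heckeSMul_levelIdem` — `e_K ∈ H(G, K')` acts on `V^{K'}` as the level idempotent of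
  `T5LevelIdempotent` (T5-35): `e_K • w = levelAverage ρ K w`, the projector onto `V^K`.

In the record: `H(G) = ⋃_{K} H(G, K)` along the directed system of compact open subgroups, and a
smooth `π = ⋃_K π^K` is a non-degenerate `H(G)`-module (T5-38 / T5-41 on the abstract side); what
stays prose is the identification of the colimit with the convolution algebra `C_c^∞(G)` and the
Haar normalisation.

README §8(d): uses an L-value-free non-vanishing device: NO.
-/

namespace Summit.Ventures.HodgeRepro2.T5HeckeCorner

noncomputable section

open Summit.Ventures.HodgeRepro2.LevelPositivity
open Summit.Ventures.HodgeRepro2.T5LevelIdempotent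
open Summit.Ventures.HodgeRepro2.T5HeckePermutationModule
open Summit.Ventures.HodgeRepro2.T5HeckeDoubleCoset
open MonoidAlgebra Representation MulAction
open scoped Pointwise

variable {G : Type*} [Group G] {k : Type*} [Field k]

section Maps

variable (k) (K K' : Subgroup G)

/-- The coset `K ∈ G ⧸ K` is fixed by `K'` when `K' ≤ K`. -/
theorem single_one_mem_invariants_of_le (hle : K' ≤ K) :
    single ((1 : G) : G ⧸ K) (1 : k) ∈ invariants (ofMulAction k G (G ⧸ K)) K' := by
  rw [mem_invariants_iff]
  intro g hg
  rw [ofMulAction_single, MulAction.Quotient.smul_coe, smul_eq_mul, mul_one]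
  congr 1
  exact QuotientGroup.eq.2 (by simpa using inv_mem (hle hg))

/-- The projection `k[G ⧸ K'] → k[G ⧸ K]`, `xK' ↦ xK`. -/
def proj (hle : K' ≤ K) : MonoidAlgebra k (G ⧸ K') →ₗ[k] MonoidAlgebra k (G ⧸ K) :=
  orbitLinear (ofMulAction k G (G ⧸ K)) (single ((1 : G) : G ⧸ K) 1)
    (single_one_mem_invariants_of_le k K K' hle)

/-- `proj` on a basis vector. -/
@[simp] theorem proj_single (hle : K' ≤ K) (x : G) (c : k) :
    proj k K K' hle (single (x : G ⧸ K') c) = single (x : G ⧸ K) c := by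
  rw [proj, orbitLinear_single, orbitMap_mk, ofMulAction_single, MulAction.Quotient.smul_coe,
    smul_eq_mul, mul_one, smul_single', mul_one]

/-- `proj` is `G`-equivariant. -/
theorem proj_mem_equivariantHom (hle : K' ≤ K) :
    proj k K K' hle ∈ equivariantHom (ofMulAction k G (G ⧸ K')) (ofMulAction k G (G ⧸ K)) :=
  orbitLinear_mem_equivariantHom _ _ _

/-- The `K`-orbit of the coset `K' ∈ G ⧸ K'` is the image of `K`, i.e. `K/K'`. -/
theorem mem_orbit_one_iff {x : G ⧸ K'} :
    x ∈ orbit K ((1 : G) : G ⧸ K') ↔ ∃ κ ∈ K, ((κ : G) : G ⧸ K') = x := by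
  rw [mem_orbit_iff]
  constructor
  · rintro ⟨κ, rfl⟩
    exact ⟨κ, κ.2, by change _ = (((κ : G) * 1 : G) : G ⧸ K'); rw [mul_one]⟩
  · rintro ⟨κ, hκ, rfl⟩
    exact ⟨⟨κ, hκ⟩, by change (((κ : G) * 1 : G) : G ⧸ K') = _; rw [mul_one]⟩

/-- The stabiliser in `K` of the coset `K' ∈ G ⧸ K'` is `K'` (as a subgroup of `K`). -/
theorem stabilizer_one_eq : stabilizer K ((1 : G) : G ⧸ K') = K'.subgroupOf K := by
  ext κ
  rw [MulAction.mem_stabilizer_iff, Subgroup.mem_subgroupOf]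
  change (((κ : G) * 1 : G) : G ⧸ K') = ((1 : G) : G ⧸ K') ↔ _
  rw [mul_one, QuotientGroup.eq, mul_one, Subgroup.inv_mem_iff]

/-- The indicator `1_{K/K'} ∈ k[G ⧸ K']` is `K`-fixed. -/
theorem levelVector_mem_invariants [Finite (orbit K ((1 : G) : G ⧸ K'))] :
    orbitVector k K' (orbit K ((1 : G) : G ⧸ K')) ∈ invariants (ofMulAction k G (G ⧸ K')) K := by
  rw [mem_invariants_iff]
  intro κ hκ
  rw [ofMulAction_orbitVector k K' (Set.toFinite _) κ]
  congr 1
  exact smul_orbit (⟨κ, hκ⟩ : K) ((1 : G) : G ⧸ K')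

/-- The number `[K : K'] = #(K/K')` as an element of `k`. -/
def levelIndex : k := ((orbit K ((1 : G) : G ⧸ K')).ncard : k)

/-- The section `k[G ⧸ K] → k[G ⧸ K']`, `xK ↦ [K : K']⁻¹ ∑_{y ∈ xK/K'} yK'`: the `G`-map sending
`δ_K` to `[K : K']⁻¹ 1_{K/K'}`. -/
def sect [Finite (orbit K ((1 : G) : G ⧸ K'))] :
    MonoidAlgebra k (G ⧸ K) →ₗ[k] MonoidAlgebra k (G ⧸ K') :=
  orbitLinear (ofMulAction k G (G ⧸ K')) ((levelIndex k K K')⁻¹ • orbitVector k K' (orbit K ((1 : G) : G ⧸ K')))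
    (Submodule.smul_mem _ _ (levelVector_mem_invariants k K K'))

/-- `sect` is `G`-equivariant. -/
theorem sect_mem_equivariantHom [Finite (orbit K ((1 : G) : G ⧸ K'))] :
    sect k K K' ∈ equivariantHom (ofMulAction k G (G ⧸ K)) (ofMulAction k G (G ⧸ K')) :=
  orbitLinear_mem_equivariantHom _ _ _

/-- `sect δ_K = [K : K']⁻¹ 1_{K/K'}`. -/
theorem sect_single_one [Finite (orbit K ((1 : G) : G ⧸ K'))] :
    sect k K K' (single ((1 : G) : G ⧸ K) 1) =
      (levelIndex k K K')⁻¹ • orbitVector k K' (orbit K ((1 : G) : G ⧸ K')) := by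
  rw [sect, orbitLinear_single_one]

/-- `proj` maps every basis vector of the orbit `K/K'` to `δ_K`. -/
theorem proj_single_of_mem_orbit (hle : K' ≤ K) {x : G ⧸ K'} (hx : x ∈ orbit K ((1 : G) : G ⧸ K')) :
    proj k K K' hle (single x 1) = single ((1 : G) : G ⧸ K) 1 := by
  obtain ⟨κ, hκ, rfl⟩ := (mem_orbit_one_iff K K').mp hx
  rw [proj_single]
  congr 1
  exact QuotientGroup.eq.2 (by simpa using inv_mem hκ)

/-- `proj (1_{K/K'}) = [K : K'] δ_K`. -/
theorem proj_orbitVector (hle : K' ≤ K) [Finite (orbit K ((1 : G) : G ⧸ K'))] :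
    proj k K K' hle (orbitVector k K' (orbit K ((1 : G) : G ⧸ K'))) =
      levelIndex k K K' • single ((1 : G) : G ⧸ K) 1 := by
  rw [orbitVector, finsum_mem_eq_finite_toFinset_sum _ (Set.toFinite _), map_sum]
  rw [Finset.sum_congr rfl fun x hx => proj_single_of_mem_orbit k K K' hle
    ((Set.Finite.mem_toFinset _).mp hx)]
  rw [Finset.sum_const, levelIndex, Set.ncard_eq_toFinset_card _ (Set.toFinite _),
    Nat.cast_smul_eq_nsmul]

/-- `[K : K'] ≠ 0` in `k` (characteristic `0`, the orbit non-empty and finite). -/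
theorem levelIndex_ne_zero [CharZero k] [Finite (orbit K ((1 : G) : G ⧸ K'))] :
    levelIndex k K K' ≠ 0 := by
  rw [levelIndex]
  exact_mod_cast (Set.ncard_pos (Set.toFinite _)).mpr ⟨_, mem_orbit_self _⟩ |>.ne'

/-- `proj ∘ sect = id`. -/
theorem proj_comp_sect [CharZero k] (hle : K' ≤ K) [Finite (orbit K ((1 : G) : G ⧸ K'))] :
    proj k K K' hle ∘ₗ sect k K K' = LinearMap.id := by
  have hmem : proj k K K' hle ∘ₗ sect k K K' ∈
      equivariantHom (ofMulAction k G (G ⧸ K)) (ofMulAction k G (G ⧸ K)) := by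
    intro g x
    simp only [LinearMap.coe_comp, Function.comp_apply]
    rw [sect_mem_equivariantHom k K K' g x, proj_mem_equivariantHom k K K' hle g]
  refine equivariantHom_ext _ hmem (by intro g x; rfl) ?_
  simp only [LinearMap.coe_comp, Function.comp_apply, LinearMap.id_coe, id_eq]
  rw [sect_single_one, map_smul, proj_orbitVector, smul_smul,
    inv_mul_cancel₀ (levelIndex_ne_zero k K K'), one_smul]

/-- `proj (sect y) = y`. -/
theorem proj_sect [CharZero k] (hle : K' ≤ K) [Finite (orbit K ((1 : G) : G ⧸ K'))]
    (y : MonoidAlgebra k (G ⧸ K)) :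
    proj k K K' hle (sect k K K' y) = y :=
  LinearMap.congr_fun (proj_comp_sect k K K' hle) y

end Maps

section Inclusion

variable (k) (K K' : Subgroup G) (hle : K' ≤ K) [CharZero k] [Finite (orbit K ((1 : G) : G ⧸ K'))]

/-- THE INCLUSION `H(G, K) → H(G, K')`, `T ↦ sect ∘ T ∘ proj`. -/
def incl (T : heckeAlgebra k K) : heckeAlgebra k K' :=
  ⟨sect k K K' ∘ₗ T.1 ∘ₗ proj k K K' hle, by
    rw [mem_heckeAlgebra_iff_mem_equivariantHom]
    intro g x
    simp only [LinearMap.coe_comp, Function.comp_apply]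
    rw [proj_mem_equivariantHom k K K' hle g, heckeAlgebra_apply_ofMulAction,
      sect_mem_equivariantHom k K K' g]⟩

omit [CharZero k] in
/-- `incl` unfolded. -/
@[simp] theorem incl_coe (T : heckeAlgebra k K) :
    (incl k K K' hle T).1 = sect k K K' ∘ₗ T.1 ∘ₗ proj k K K' hle := rfl

/-- `incl` is multiplicative (`proj ∘ sect = id`). -/
theorem incl_mul (T T' : heckeAlgebra k K) :
    incl k K K' hle (T * T') = incl k K K' hle T * incl k K K' hle T' := by
  apply Subtype.ext
  apply LinearMap.ext
  intro x
  simp only [incl_coe, Subalgebra.coe_mul, Module.End.mul_apply, LinearMap.coe_comp,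
    Function.comp_apply, proj_sect]

omit [CharZero k] in
/-- `incl` is additive. -/
theorem incl_add (T T' : heckeAlgebra k K) :
    incl k K K' hle (T + T') = incl k K K' hle T + incl k K K' hle T' := by
  apply Subtype.ext
  apply LinearMap.ext
  intro x
  simp [incl_coe]

omit [CharZero k] in
/-- `incl` is `k`-linear. -/
theorem incl_smul (c : k) (T : heckeAlgebra k K) :
    incl k K K' hle (c • T) = c • incl k K K' hle T := by
  apply Subtype.ext
  apply LinearMap.ext
  intro x
  simp [incl_coe]

/-- `incl` as a `k`-linear map. -/
def inclₗ : heckeAlgebra k K →ₗ[k] heckeAlgebra k K' where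
  toFun := incl k K K' hle
  map_add' := incl_add k K K' hle
  map_smul' := incl_smul k K K' hle

/-- `incl` is injective (`proj ∘ incl T ∘ sect = T`). -/
theorem incl_injective : Function.Injective (incl k K K' hle) := by
  intro T T' h
  apply Subtype.ext
  apply LinearMap.ext
  intro y
  have h1 := LinearMap.congr_fun (congrArg Subtype.val h) (sect k K K' y)
  simp only [incl_coe, LinearMap.coe_comp, Function.comp_apply, proj_sect] at h1
  have h2 := congrArg (proj k K K' hle) h1
  rwa [proj_sect, proj_sect] at h2

/-- THE LEVEL IDEMPOTENT `e_K := sect ∘ proj ∈ H(G, K')`. -/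
def levelIdem : heckeAlgebra k K' := incl k K K' hle 1

omit [CharZero k] in
/-- `e_K` unfolded. -/
theorem levelIdem_coe : (levelIdem k K K' hle).1 = sect k K K' ∘ₗ proj k K K' hle := by
  rw [levelIdem, incl_coe, OneMemClass.coe_one, Module.End.one_eq_id, LinearMap.id_comp]

/-- `e_K` is idempotent. -/
theorem isIdempotentElem_levelIdem : IsIdempotentElem (levelIdem k K K' hle) := by
  show levelIdem k K K' hle * levelIdem k K K' hle = levelIdem k K K' hle
  rw [levelIdem, ← incl_mul, mul_one]

/-- The image of `incl` lies in the corner `e_K H(G, K') e_K`. -/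
theorem incl_eq_levelIdem_mul_mul (T : heckeAlgebra k K) :
    incl k K K' hle T = levelIdem k K K' hle * incl k K K' hle T * levelIdem k K K' hle := by
  rw [levelIdem, ← incl_mul, ← incl_mul, one_mul, mul_one]

omit [CharZero k] in
/-- The corner `e_K H(G, K') e_K` lies in the image of `incl`: `e_K T' e_K = incl (proj ∘ T' ∘ sect)`. -/
theorem exists_incl_eq_of_corner (T' : heckeAlgebra k K') :
    ∃ T : heckeAlgebra k K, incl k K K' hle T = levelIdem k K K' hle * T' * levelIdem k K K' hle := by
  refine ⟨⟨proj k K K' hle ∘ₗ T'.1 ∘ₗ sect k K K', ?_⟩, ?_⟩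
  · rw [mem_heckeAlgebra_iff_mem_equivariantHom]
    intro g x
    simp only [LinearMap.coe_comp, Function.comp_apply]
    rw [sect_mem_equivariantHom k K K' g, heckeAlgebra_apply_ofMulAction,
      proj_mem_equivariantHom k K K' hle g]
  · apply Subtype.ext
    apply LinearMap.ext
    intro x
    simp only [incl_coe, levelIdem_coe, Subalgebra.coe_mul, Module.End.mul_apply, LinearMap.coe_comp,
      Function.comp_apply]

end Inclusion

section Action

variable {V : Type*} [AddCommGroup V] [Module k V] (ρ : Representation k G V)
variable (K K' : Subgroup G) [CharZero k] [Finite (orbit K ((1 : G) : G ⧸ K'))]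

omit [CharZero k] [Finite (orbit K ((1 : G) : G ⧸ K'))] in
/-- `V^K ⊆ V^{K'}` for `K' ≤ K`. -/
theorem invariants_le_of_le (hle : K' ≤ K) : invariants ρ K ≤ invariants ρ K' := by
  intro v hv
  rw [mem_invariants_iff] at hv ⊢
  exact fun g hg => hv g (hle hg)

/-- The inclusion `V^K → V^{K'}`. -/
def inclInv (hle : K' ≤ K) (v : invariants ρ K) : invariants ρ K' :=
  ⟨v.1, invariants_le_of_le ρ K K' hle v.2⟩

/-- THE ACTIONS ARE COMPATIBLE: on `V^K ⊆ V^{K'}`, `incl T` acts as `T`. -/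
theorem heckeSMul_incl (hle : K' ≤ K) (T : heckeAlgebra k K) (v : invariants ρ K) :
    (heckeSMul ρ (incl k K K' hle T) (inclInv ρ K K' hle v) : V) = heckeSMul ρ T v := by
  rw [heckeSMul_coe, heckeSMul_coe, incl_coe]
  simp only [LinearMap.coe_comp, Function.comp_apply]
  -- `f_v^{K'} = f_v^K ∘ proj` (both `G`-maps `k[G ⧸ K'] → V` with value `v` at `δ_{K'}`)
  have hcomp : orbitLinear ρ (inclInv ρ K K' hle v).1 (inclInv ρ K K' hle v).2 =
      orbitLinear ρ v.1 v.2 ∘ₗ proj k K K' hle := by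
    have hmem : orbitLinear ρ v.1 v.2 ∘ₗ proj k K K' hle ∈
        equivariantHom (ofMulAction k G (G ⧸ K')) ρ := by
      intro g x
      simp only [LinearMap.coe_comp, Function.comp_apply]
      rw [proj_mem_equivariantHom k K K' hle g, orbitLinear_mem_equivariantHom ρ v.1 v.2 g]
    refine equivariantHom_ext ρ (orbitLinear_mem_equivariantHom ρ _ _) hmem ?_
    simp only [LinearMap.coe_comp, Function.comp_apply]
    rw [orbitLinear_single_one]
    have : proj k K K' hle (single ((1 : G) : G ⧸ K') 1) = single ((1 : G) : G ⧸ K) 1 :=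
      proj_single k K K' hle 1 1
    rw [this, orbitLinear_single_one]
    rfl
  rw [hcomp]
  simp only [LinearMap.coe_comp, Function.comp_apply]
  rw [proj_sect]
  have : proj k K K' hle (single ((1 : G) : G ⧸ K') 1) = single ((1 : G) : G ⧸ K) 1 :=
    proj_single k K K' hle 1 1
  rw [this]

/-- `e_K ∈ H(G, K')` ACTS ON `V^{K'}` AS THE LEVEL IDEMPOTENT OF T5-35: `e_K • w = levelAverage ρ K w`,
the projector onto `V^K`. -/
theorem heckeSMul_levelIdem (hle : K' ≤ K) (w : invariants ρ K') :
    (heckeSMul ρ (levelIdem k K K' hle) w : V) = levelAverage ρ K w := by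
  rw [heckeSMul_coe, levelIdem_coe]
  simp only [LinearMap.coe_comp, Function.comp_apply]
  have hp : proj k K K' hle (single ((1 : G) : G ⧸ K') 1) = single ((1 : G) : G ⧸ K) 1 :=
    proj_single k K K' hle 1 1
  rw [hp, sect_single_one, map_smul, orbitVector,
    finsum_mem_eq_finite_toFinset_sum _ (Set.toFinite _), map_sum]
  simp only [orbitLinear_single, one_smul]
  haveI hfi : (stabilizer K ((1 : G) : G ⧸ K')).FiniteIndex := by
    haveI : Finite (K ⧸ stabilizer K ((1 : G) : G ⧸ K')) :=
      Finite.of_equiv _ (orbitEquivQuotientStabilizer K _)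
    exact Subgroup.finiteIndex_of_finite_quotient
  have hH : stabilizer K ((1 : G) : G ⧸ K') ≤ stabilizerIn ρ K w := by
    intro κ hκ
    rw [stabilizer_one_eq, Subgroup.mem_subgroupOf] at hκ
    rw [mem_stabilizerIn_iff]
    exact mem_invariants_iff.mp w.2 κ hκ
  have h0 : ((stabilizer K ((1 : G) : G ⧸ K')).index : k) ≠ 0 :=
    Nat.cast_ne_zero.2 Subgroup.FiniteIndex.index_ne_zero
  rw [levelAverage_eq hH h0, index_stabilizer, levelIndex]
  congr 1
  rw [← finsum_mem_eq_finite_toFinset_sum _ (Set.toFinite _), ← finsum_set_coe_eq_finsum_mem]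
  unfold cosetSum
  refine finsum_eq_of_bijective (orbitEquivQuotientStabilizer K ((1 : G) : G ⧸ K'))
    (orbitEquivQuotientStabilizer K _).bijective (fun x => ?_)
  set c := orbitEquivQuotientStabilizer K ((1 : G) : G ⧸ K') x with hc
  have hx : (x : G ⧸ K') = (Quotient.out c : K) • ((1 : G) : G ⧸ K') := by
    rw [← orbitEquivQuotientStabilizer_symm_apply K ((1 : G) : G ⧸ K') (Quotient.out c),
      QuotientGroup.out_eq', hc, Equiv.symm_apply_apply]
  rw [hx]
  change orbitMap ρ w.1 w.2 ((((Quotient.out c : K) : G) * 1 : G) : G ⧸ K') = _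
  rw [mul_one, orbitMap_mk]

end Action

end

end Summit.Ventures.HodgeRepro2.T5HeckeCorner
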